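import Summits.QuantumFields.YangMills.Theorems.ColdStartUniversalityLatticeLangevinNoiseStochasticRotation
import Summits.QuantumFields.YangMills.Theorems.ColdStartUniversalityLatticeLangevinWeakSolutionLaw
import HarnessLib

/-!
# Route `ColdStartUniversality` (coupling infrastructure): solutions driven by a ROTATED NOISE `∫ R dB` have the SZZ
# transition laws — the marginal clause (L1) of `UnitScaleMixedCoupling`, unconditionally in the driver

Helper file (seat `ym-line-csu-p1`, g13; `--supports stmt-QuantumFields-27872`).  One user-facing statement combining
`exists_isFlatBrownian_stochasticRotation` ((G1): the rotated noise is a flat Brownian motion of `σ(B)` in martingale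
form with a flat modification) and `map_eq_of_solution_martingaleDriver` ((G3): uniqueness in law for `σ(B)`-weak
solutions):

* ★ `exists_rotatedNoise_forall_solution_map_eq` — for a flat Brownian motion `B` and a `σ(B)`-progressive matrix process
  `R` with `R Rᵀ = 1` there is a rotated noise `W'` (`W'ᵃ = Σ_b ∫ R_{ab} dB^b`, Itô integrals w.r.t. `σ(B)`) such that
  EVERY `σ(B)`-adapted solution `V` of the SU(2) SZZ system driven by `W'` from a deterministic start `v` has, at every
  time, the law of THE strong solution from `v` (any flat driver on any space) — i.e. `∫ f(V_t) dP = P_t f(v)`, the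
  `IsCoupling` marginal clause of items 27872/27873 for the `W'`-driven component.

What remains for `defn-UnitScaleMixedCoupling` is (G2) only: EXISTENCE of the feedback-coupled pair (the mirror `R`
depends on both solutions).  THEOREMS ONLY, no sorry, standard axioms.  HONEST FRAMING: plumbing; no coupling is
constructed, no contraction / overlap estimate, nothing uniform in the cut-off; no crux, rung R3 or summit is proved;
the Yang–Mills mass gap is NOT proved.
-/

set_option autoImplicit false

noncomputable section

namespace Summit.QuantumFields.YangMills.Theorems.ColdStartUniversality

open MeasureTheory ProbabilityTheory Filter
open scoped NNReal ENNReal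
open Literature.Probability.Process Literature.MathematicalPhysics.QuantumFieldTheory
open Literature.MathematicalPhysics.QuantumLattice (fundamentalRep fundamentalLatticeRep)

variable {Ω : Type} {mΩ : MeasurableSpace Ω} {P : Measure Ω} {L : ℕ} [NeZero L]
  {B : ℝ≥0 → Ω → (Edge 3 L × NoiseIdx 2 → ℝ)}

/-- ★ **Solutions driven by a rotated noise have the SZZ transition laws.**  For a flat Brownian motion `B` and a
`σ(B)`-progressive matrix process `R` on `Edge 3 L × NoiseIdx 2` with `R Rᵀ = 1`, there is a process `W'` with
`W'ᵃ = Σ_b ∫ R_{ab} dB^b` (Itô integrals w.r.t. `hB.natFiltration`) such that for every coupling `β'`, start `v` and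
EVERY `hB.natFiltration`-adapted solution `V` of the SU(2) SZZ system driven by `W'` with `V 0 = v`:
`law(V_t) = law(U_t)` for any strong solution `U` from `v` driven by any flat Brownian motion on any probability space.
[cite: RevuzYor1999, Ch. IX Thm (1.7)] -/
theorem exists_rotatedNoise_forall_solution_map_eq [IsProbabilityMeasure P] (hB : IsFlatBrownian B P)
    (R : ℝ≥0 → Ω → Matrix (Edge 3 L × NoiseIdx 2) (Edge 3 L × NoiseIdx 2) ℝ)
    (hR : ∀ a b, IsStronglyProgressive hB.natFiltration (fun t ω => R t ω a b))
    (hRO : ∀ t ω, R t ω * (R t ω).transpose = 1) :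
    ∃ W' : ℝ≥0 → Ω → (Edge 3 L × NoiseIdx 2 → ℝ),
      (∃ J : (Edge 3 L × NoiseIdx 2) → (Edge 3 L × NoiseIdx 2) → ℝ≥0 → Ω → ℝ,
        (∀ a b, IsItoIntegral (fun t ω => R t ω a b) (fun t ω => B t ω b) (J a b) hB.natFiltration P) ∧
        ∀ t ω a, W' t ω a = ∑ b, J a b t ω) ∧
      ∀ (β' : ℝ) (v : GaugeConfig 3 L (Matrix.specialUnitaryGroup (Fin 2) ℂ))
        (V : ℝ≥0 → Ω → GaugeConfig 3 L (Matrix.specialUnitaryGroup (Fin 2) ℂ)),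
        (∀ ω, V 0 ω = v) →
        (latticeLangevinDynamics (fundamentalLatticeRep 2) β').IsSolution (fundamentalRep (Fin 2))
          hB.natFiltration P W' V →
        ∀ (Ω₂ : Type) [MeasurableSpace Ω₂] (P₂ : Measure Ω₂) [IsProbabilityMeasure P₂]
          (W₂ : ℝ≥0 → Ω₂ → (Edge 3 L × NoiseIdx 2 → ℝ)) (hW₂ : IsFlatBrownian W₂ P₂)
          (U₂ : ℝ≥0 → Ω₂ → GaugeConfig 3 L (Matrix.specialUnitaryGroup (Fin 2) ℂ)),
          (∀ ω, U₂ 0 ω = v) →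
          (latticeLangevinDynamics (fundamentalLatticeRep 2) β').IsSolution (fundamentalRep (Fin 2))
            hW₂.natFiltration P₂ W₂ U₂ →
          ∀ t : ℝ≥0, P.map (V t) = P₂.map (U₂ t) := by
  classical
  obtain ⟨W', Wt, hJ, hM, hMM, -, hWt, hae⟩ := exists_isFlatBrownian_stochasticRotation hB R hR hRO
  refine ⟨W', hJ, fun β' v V hV0 hV Ω₂ _ P₂ _ W₂ hW₂ U₂ hU₂0 hU₂ t => ?_⟩
  exact map_eq_of_solution_martingaleDriver β' v hM hMM hWt hae hV0 hV hW₂ hU₂0 hU₂ t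

end Summit.QuantumFields.YangMills.Theorems.ColdStartUniversality

end
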